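import Literature.Claims.NS.PanPan2025
import HarnessLib

/-!
# C97 `PanPan2025` — refutation certificate against `Literature.Claims.NS.PanPan2025` (cell
`ns-claims`, D-0090; refuter of record ns-claims-refuter-1; skeleton typist-10 g2 p487900)

Text of record: Tao Pan & Yueyu Pan, Zenodo 16471728 (= SSRN 5355152), «20250719.pdf», 69 pp.
(PDF page = printed page). The first failing step of the printed derivation of Constraint 1
(§3.2.1 pp.26–28) is **p.27 d8**: «Utilizing the three-dimensional Sobolev embedding H¹ ↪ L⁶ and
Hölder's inequality: ‖∇((u·∇)u)‖_{L²} ≤ C‖u‖_{L⁶}‖∇u‖_{L³}», typed as `Step_C1a` (a universal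
constant `C`, all smooth compactly supported divergence-free fields). The two sides scale
differently under dilation `v ↦ v(λ·)` — left `λ^{1/2}`, right `λ^{−1/2}` — so no constant works.

* `not_Step_C1a` — witness family: the compactly supported smooth swirl
  `w(x) = e^{−1/(1−|x|²)} (x₁, −x₀, 0)` (zero outside the unit ball; divergence free), dilated.
  At the origin `∂₀((w·∇)w)(0) = −w… = −c₀² e₀` with `c₀ = e^{−1} > 0`, so the left side of d8 is
  positive for `w`; for `w_λ = w(λ·)` it equals `√λ ·` (its value at `w`) while the right side is
  at most `|C| ‖w‖_{L⁶} ‖∇w‖_{L³}` for `λ ≥ 1`.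

Nothing here decides Clay (A). WHAT THIS IS NOT: not a claim about NS regularity or blow-up; not
a claim about any author beyond the typed locator.
-/

set_option linter.dupNamespace false

open Set MeasureTheory Function
open scoped ContDiff

namespace Summit.NavierStokesRegularity.NavierStokesRegularity.Theorems.PanPan2025

open Literature.Analysis.FluidPDE Literature.Claims.NS.PanPan2025

noncomputable section

/-- `ℝ³` (plumbing). [folklore] -/
abbrev E3 : Type := EuclideanSpace ℝ (Fin 3)

/-- Standard basis vector `eᵢ`. [folklore] -/
def bv (i : Fin 3) : E3 := EuclideanSpace.single i 1

/-! ## Dilations `x ↦ w(λx)` and how the three quantities of d8 scale -/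

/-- The dilation `w_λ(x) = w(λx)`. [folklore] -/
def dil (l : ℝ) (w : E3 → E3) (x : E3) : E3 := w (l • x)

/-- Dilation preserves smoothness. [folklore] -/
theorem contDiff_dil {l : ℝ} {w : E3 → E3} (hw : ContDiff ℝ ∞ w) : ContDiff ℝ ∞ (dil l w) :=
  hw.comp (contDiff_const_smul l)

/-- Dilation by `λ ≠ 0` preserves compact support. [folklore] -/
theorem hasCompactSupport_dil {l : ℝ} {w : E3 → E3} (hw : HasCompactSupport w) (hl : l ≠ 0) :
    HasCompactSupport (dil l w) :=
  hw.comp_smul hl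

/-- Chain rule: `D(w_λ)(x) = Dw(λx) ∘ (λ·)`. [folklore] -/
theorem hasFDerivAt_dil {l : ℝ} {w : E3 → E3} (hw : Differentiable ℝ w) (x : E3) :
    HasFDerivAt (dil l w) ((fderiv ℝ w (l • x)).comp (l • ContinuousLinearMap.id ℝ E3)) x :=
  (hw (l • x)).hasFDerivAt.comp x ((hasFDerivAt_id x).const_smul l)

/-- `D(w_λ)(x) = λ · Dw(λx)` as continuous linear maps. [folklore] -/
theorem fderiv_dil {l : ℝ} {w : E3 → E3} (hw : Differentiable ℝ w) (x : E3) :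
    fderiv ℝ (dil l w) x = l • fderiv ℝ w (l • x) := by
  rw [(hasFDerivAt_dil hw x).fderiv]
  ext u i
  simp

/-- Dilation preserves incompressibility. [folklore] -/
theorem isDivFree_dil {l : ℝ} {w : E3 → E3} (hw : Differentiable ℝ w)
    (hdiv : VectorCalculus.IsDivFree w) : VectorCalculus.IsDivFree (dil l w) := by
  intro x
  have h := hdiv (l • x)
  unfold VectorCalculus.divergence at h ⊢
  rw [fderiv_dil hw x, ContinuousLinearMap.toLinearMap_smul, map_smul, h, smul_zero]

/-- `(w_λ·∇)w_λ (x) = λ · ((w·∇)w)(λx)`. [folklore] -/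
theorem convect_dil {l : ℝ} {w : E3 → E3} (hw : Differentiable ℝ w) :
    convect (dil l w) (dil l w) = fun x => l • dil l (convect w w) x := by
  funext x
  simp only [convect, dil, fderiv_dil hw x]
  rfl

/-- `∂ᵤ((w_λ·∇)w_λ)(x) = λ² · ∂ᵤ((w·∇)w)(λx)`. [folklore] -/
theorem fderiv_convect_dil {l : ℝ} {w : E3 → E3} (hw : Differentiable ℝ w)
    (hN : Differentiable ℝ (convect w w)) (x u : E3) :
    fderiv ℝ (convect (dil l w) (dil l w)) x u = l ^ 2 • fderiv ℝ (convect w w) (l • x) u := by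
  rw [convect_dil hw]
  have hd : DifferentiableAt ℝ (dil l (convect w w)) x := (hasFDerivAt_dil hN x).differentiableAt
  show fderiv ℝ (l • dil l (convect w w)) x u = _
  rw [fderiv_const_smul hd, fderiv_dil hN x, smul_smul, ← sq]
  rfl

/-- Change of variables `∫ F(λx) dx = λ⁻³ ∫ F` on `ℝ³` (`λ > 0`). [folklore] -/
theorem integral_dil {l : ℝ} (hl : 0 < l) (F : E3 → ℝ) :
    ∫ x, F (l • x) = (l ^ 3)⁻¹ * ∫ x, F x := by
  have h := Measure.integral_comp_smul (volume : Measure E3) F l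
  rw [h, smul_eq_mul, finrank_euclideanSpace_fin, abs_of_pos (inv_pos.2 (pow_pos hl 3))]

/-- Scaling of `‖∂ᵤ((v·∇)v)‖²_{L²}`: factor `λ`. [folklore] -/
theorem l2Sq_fderiv_convect_dil {l : ℝ} (hl : 0 < l) {w : E3 → E3} (hw : Differentiable ℝ w)
    (hN : Differentiable ℝ (convect w w)) (u : E3) :
    l2Sq (fun x => fderiv ℝ (convect (dil l w) (dil l w)) x u) =
      l * l2Sq (fun x => fderiv ℝ (convect w w) x u) := by
  unfold l2Sq
  simp only [fderiv_convect_dil hw hN, norm_smul, mul_pow, Real.norm_eq_abs]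
  rw [integral_const_mul, integral_dil hl (fun x => ‖fderiv ℝ (convect w w) x u‖ ^ 2),
    abs_of_pos (pow_pos hl 2)]
  have hl0 : l ≠ 0 := hl.ne'
  field_simp

/-- Scaling of `∫ ‖v‖⁶`: factor `λ⁻³`. [folklore] -/
theorem integral_norm_pow_six_dil {l : ℝ} (hl : 0 < l) (w : E3 → E3) :
    ∫ x, ‖dil l w x‖ ^ 6 = (l ^ 3)⁻¹ * ∫ x, ‖w x‖ ^ 6 :=
  integral_dil hl (fun x => ‖w x‖ ^ 6)

/-- The squared Frobenius norm is homogeneous of degree two. [folklore] -/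
theorem frobeniusNormSq_smul (l : ℝ) (A : E3 →L[ℝ] E3) :
    frobeniusNormSq (l • A) = l ^ 2 * frobeniusNormSq A := by
  unfold frobeniusNormSq
  rw [Finset.mul_sum]
  refine Finset.sum_congr rfl fun i _ => ?_
  rw [show (l • A) (stdOrthonormalBasis ℝ E3 i) = l • A (stdOrthonormalBasis ℝ E3 i) from rfl,
    norm_smul, mul_pow, Real.norm_eq_abs, sq_abs]

/-- Scaling of `∫ |∇v|³` (= `∫ (|∇v|²)^{3/2}`): invariant. [folklore] -/
theorem integral_frob_dil {l : ℝ} (hl : 0 < l) {w : E3 → E3} (hw : Differentiable ℝ w) :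
    ∫ x, (frobeniusNormSq (fderiv ℝ (dil l w) x)) ^ ((3:ℝ) / 2) =
      ∫ x, (frobeniusNormSq (fderiv ℝ w x)) ^ ((3:ℝ) / 2) := by
  have hpow : (l ^ 2) ^ ((3:ℝ) / 2) = l ^ 3 := by
    rw [← Real.rpow_natCast l 2, ← Real.rpow_mul hl.le]
    norm_num
  simp only [fderiv_dil hw, frobeniusNormSq_smul,
    Real.mul_rpow (sq_nonneg l) (frobeniusNormSq_nonneg _), hpow]
  rw [integral_const_mul,
    integral_dil hl (fun x => (frobeniusNormSq (fderiv ℝ w x)) ^ ((3:ℝ) / 2))]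
  have hl0 : l ^ 3 ≠ 0 := pow_ne_zero 3 hl.ne'
  field_simp

/-! ## The swirl `w(x) = e^{−1/(1−|x|²)} (x₁, −x₀, 0)` -/

/-- The rotation generator `R x = (x₁, −x₀, 0)`. [folklore] -/
def ppRot : E3 →L[ℝ] E3 :=
  (EuclideanSpace.proj (1 : Fin 3) : E3 →L[ℝ] ℝ).smulRight (bv 0) -
    (EuclideanSpace.proj (0 : Fin 3) : E3 →L[ℝ] ℝ).smulRight (bv 1)

/-- `R x = x₁ e₀ − x₀ e₁`. [folklore] -/
theorem ppRot_apply (x : E3) : ppRot x = x 1 • bv 0 - x 0 • bv 1 := by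
  simp [ppRot]

/-- The radial cutoff `c(x) = expNegInvGlue (1 − ‖x‖²)` (zero for `‖x‖ ≥ 1`). [folklore] -/
def ppCut (x : E3) : ℝ := expNegInvGlue (1 - ‖x‖ ^ 2)

/-- The swirl field `w = c · R`. [folklore] -/
def ppSwirl (x : E3) : E3 := ppCut x • ppRot x

/-- The cutoff is smooth. [folklore] -/
theorem contDiff_ppCut : ContDiff ℝ ∞ ppCut :=
  expNegInvGlue.contDiff.comp (contDiff_const.sub (contDiff_norm_sq ℝ))

/-- The swirl is smooth. [folklore] -/
theorem contDiff_ppSwirl : ContDiff ℝ ∞ ppSwirl :=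
  contDiff_ppCut.smul ppRot.contDiff

/-- The swirl vanishes outside the closed unit ball. [folklore] -/
theorem hasCompactSupport_ppSwirl : HasCompactSupport ppSwirl := by
  refine HasCompactSupport.intro (isCompact_closedBall (0 : E3) 1) fun x hx => ?_
  have hx1 : 1 < ‖x‖ := by simpa [Metric.mem_closedBall, dist_zero_right] using hx
  have hle : 1 - ‖x‖ ^ 2 ≤ 0 := by nlinarith
  simp [ppSwirl, ppCut, expNegInvGlue.zero_of_nonpos hle]

/-- Derivative of the cutoff: `Dc(x) = E′(1 − ‖x‖²) · (−2⟨x, ·⟩)`. [folklore] -/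
theorem hasFDerivAt_ppCut (x : E3) :
    HasFDerivAt ppCut (deriv expNegInvGlue (1 - ‖x‖ ^ 2) • ((0 : E3 →L[ℝ] ℝ) - 2 • innerSL ℝ x))
      x := by
  have hE : HasDerivAt expNegInvGlue (deriv expNegInvGlue (1 - ‖x‖ ^ 2)) (1 - ‖x‖ ^ 2) :=
    (((expNegInvGlue.contDiff (n := 1)).differentiable (by simp)) _).hasDerivAt
  have hq : HasFDerivAt (fun y : E3 => 1 - ‖y‖ ^ 2) ((0 : E3 →L[ℝ] ℝ) - 2 • innerSL ℝ x) x :=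
    (hasFDerivAt_const (1 : ℝ) x).sub (hasStrictFDerivAt_norm_sq x).hasFDerivAt
  exact hE.comp_hasFDerivAt x hq

/-- Derivative of the swirl (product rule). [folklore] -/
theorem hasFDerivAt_ppSwirl (x : E3) :
    HasFDerivAt ppSwirl (ppCut x • ppRot +
      (deriv expNegInvGlue (1 - ‖x‖ ^ 2) • ((0 : E3 →L[ℝ] ℝ) - 2 • innerSL ℝ x)).smulRight
        (ppRot x)) x :=
  (hasFDerivAt_ppCut x).smul ppRot.hasFDerivAt

/-- The swirl is differentiable. [folklore] -/
theorem differentiable_ppSwirl : Differentiable ℝ ppSwirl :=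
  fun x => (hasFDerivAt_ppSwirl x).differentiableAt

/-- **The swirl is divergence free**: `div (c(|x|²) R x) = 2c′(x₀x₁ − x₁x₀) + c · tr R = 0`.
[folklore] -/
theorem isDivFree_ppSwirl : VectorCalculus.IsDivFree ppSwirl := by
  intro x
  rw [divergence_eq_sum_inner_fderiv (EuclideanSpace.basisFun (Fin 3) ℝ),
    (hasFDerivAt_ppSwirl x).fderiv]
  simp [Fin.sum_univ_three, ppRot_apply, bv, EuclideanSpace.inner_single_left,
    EuclideanSpace.inner_single_right]
  ring

/-- `w(0) = 0`. [folklore] -/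
theorem ppSwirl_zero : ppSwirl 0 = 0 := by
  simp [ppSwirl]

/-- `Dw(0) u = c(0) · R u`. [folklore] -/
theorem fderiv_ppSwirl_zero_apply (u : E3) : fderiv ℝ ppSwirl 0 u = ppCut 0 • ppRot u := by
  rw [(hasFDerivAt_ppSwirl 0).fderiv]
  simp

/-- `c(0) = expNegInvGlue 1 > 0`. [folklore] -/
theorem ppCut_zero_pos : 0 < ppCut 0 := by
  simp only [ppCut, norm_zero]
  exact expNegInvGlue.pos_of_pos (by norm_num)

/-- The convective term `N = (w·∇)w` is smooth. [folklore] -/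
theorem contDiff_convect_ppSwirl : ContDiff ℝ ∞ (convect ppSwirl ppSwirl) := by
  have h := (contDiff_infty_iff_fderiv.1 contDiff_ppSwirl).2
  exact h.clm_apply contDiff_ppSwirl

/-- `N` is differentiable. [folklore] -/
theorem differentiable_convect_ppSwirl : Differentiable ℝ (convect ppSwirl ppSwirl) :=
  (contDiff_infty_iff_fderiv.1 contDiff_convect_ppSwirl).1

/-- **`∂₀N(0) = −c(0)² e₀`** (solid-rotation linearisation at the centre: `DN(0) = Dw(0)²`).
[folklore] -/
theorem fderiv_convect_ppSwirl_zero :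
    fderiv ℝ (convect ppSwirl ppSwirl) 0 (bv 0) = -(ppCut 0 ^ 2 • bv 0) := by
  have hc : HasFDerivAt (fun y : E3 => fderiv ℝ ppSwirl y) (fderiv ℝ (fderiv ℝ ppSwirl) 0) 0 :=
    (((contDiff_infty_iff_fderiv.1 contDiff_ppSwirl).2.differentiable (by simp)) 0).hasFDerivAt
  have hN := hc.clm_apply (hasFDerivAt_ppSwirl 0)
  rw [show convect ppSwirl ppSwirl = fun y => fderiv ℝ ppSwirl y (ppSwirl y) from rfl, hN.fderiv,
    ppSwirl_zero]
  simp [fderiv_ppSwirl_zero_apply, ppRot_apply, bv, smul_smul, sq]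

/-- The integrand `x ↦ ‖∂₀N(x)‖²` is positive at the origin. [folklore] -/
theorem normSq_fderiv_convect_zero_pos :
    0 < ‖fderiv ℝ (convect ppSwirl ppSwirl) 0 (bv 0)‖ ^ 2 := by
  rw [fderiv_convect_ppSwirl_zero, norm_neg, norm_smul, Real.norm_eq_abs,
    abs_of_nonneg (sq_nonneg _)]
  have : ‖bv 0‖ = 1 := by simp [bv]
  rw [this, mul_one]
  exact pow_pos (pow_pos ppCut_zero_pos 2) 2

/-- **`‖∂₀((w·∇)w)‖_{L²} > 0`**: a continuous compactly supported nonnegative integrand, positive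
at the origin. [folklore] -/
theorem l2Sq_fderiv_convect_ppSwirl_pos :
    0 < l2Sq (fun x => fderiv ℝ (convect ppSwirl ppSwirl) x (bv 0)) := by
  set f : E3 → ℝ := fun x => ‖fderiv ℝ (convect ppSwirl ppSwirl) x (bv 0)‖ ^ 2 with hf
  have hcontN' : Continuous (fun x => fderiv ℝ (convect ppSwirl ppSwirl) x (bv 0)) :=
    ((contDiff_infty_iff_fderiv.1 contDiff_convect_ppSwirl).2.continuous).clm_apply
      continuous_const
  have hcont : Continuous f := (hcontN'.norm).pow 2
  have hsuppN : HasCompactSupport (convect ppSwirl ppSwirl) := by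
    refine hasCompactSupport_ppSwirl.mono ?_
    intro x hx
    rw [mem_support] at hx ⊢
    intro h0
    exact hx (by simp [convect, h0])
  have hsupp : HasCompactSupport f := by
    refine hsuppN.fderiv (𝕜 := ℝ) |>.mono ?_
    intro x hx
    rw [mem_support] at hx ⊢
    intro h0
    exact hx (by simp [hf, h0])
  have hint : Integrable f := hcont.integrable_of_hasCompactSupport hsupp
  have hnn : 0 ≤ f := fun x => sq_nonneg _
  have hpos : 0 < ∫ x, f x := by
    rw [integral_pos_iff_support_of_nonneg hnn hint]
    exact hcont.isOpen_support.measure_pos volume ⟨0, normSq_fderiv_convect_zero_pos.ne'⟩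
  simpa [l2Sq, hf] using hpos

/-! ## The kill -/

/-- **Step C1a (p.27 d8) is false**: «‖∇((u·∇)u)‖_{L²} ≤ C‖u‖_{L⁶}‖∇u‖_{L³}» fails for every
constant `C` on the dilates `w(λ·)` of the swirl (left side `∝ √λ`, right side bounded for
`λ ≥ 1`). [cite: PanPan2025, §3.2.1 p.27 d8] -/
theorem not_Step_C1a : ¬ Literature.Claims.NS.PanPan2025.Step_C1a := by
  rintro ⟨C, hC⟩
  -- the three left-side pieces and the two right-side integrals of the swirl
  set N := convect ppSwirl ppSwirl with hNdef
  set S0 := l2Sq (fun x => fderiv ℝ N x (EuclideanSpace.single 0 1)) with hS0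
  set S1 := l2Sq (fun x => fderiv ℝ N x (EuclideanSpace.single 1 1)) with hS1
  set S2 := l2Sq (fun x => fderiv ℝ N x (EuclideanSpace.single 2 1)) with hS2
  set I6 := ∫ x, ‖ppSwirl x‖ ^ 6 with hI6
  set I3 := ∫ x, (frobeniusNormSq (fderiv ℝ ppSwirl x)) ^ ((3:ℝ) / 2) with hI3
  have hS0pos : 0 < S0 := l2Sq_fderiv_convect_ppSwirl_pos
  have hS1nn : 0 ≤ S1 := integral_nonneg fun _ => sq_nonneg _
  have hS2nn : 0 ≤ S2 := integral_nonneg fun _ => sq_nonneg _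
  set S := S0 + S1 + S2 with hS
  have hSpos : 0 < S := by linarith
  have hI6nn : 0 ≤ I6 := integral_nonneg fun _ => by positivity
  have hI3nn : 0 ≤ I3 := integral_nonneg fun _ => Real.rpow_nonneg (frobeniusNormSq_nonneg _) _
  set K := I6 ^ ((1:ℝ) / 6) * I3 ^ ((1:ℝ) / 3) with hK
  have hKnn : 0 ≤ K := mul_nonneg (Real.rpow_nonneg hI6nn _) (Real.rpow_nonneg hI3nn _)
  -- the dilation parameter
  set l := max 1 ((|C| * K + 1) ^ 2 / S) with hl
  have hl1 : 1 ≤ l := le_max_left _ _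
  have hl0 : 0 < l := lt_of_lt_of_le one_pos hl1
  -- instantiate d8 at the dilate
  have key := hC (dil l ppSwirl) (contDiff_dil contDiff_ppSwirl)
    (hasCompactSupport_dil hasCompactSupport_ppSwirl hl0.ne')
    (isDivFree_dil differentiable_ppSwirl isDivFree_ppSwirl)
  rw [l2Sq_fderiv_convect_dil hl0 differentiable_ppSwirl differentiable_convect_ppSwirl,
    l2Sq_fderiv_convect_dil hl0 differentiable_ppSwirl differentiable_convect_ppSwirl,
    l2Sq_fderiv_convect_dil hl0 differentiable_ppSwirl differentiable_convect_ppSwirl,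
    integral_norm_pow_six_dil hl0, integral_frob_dil hl0 differentiable_ppSwirl] at key
  rw [← hNdef, ← hS0, ← hS1, ← hS2, ← hI6, ← hI3] at key
  -- left side = √(λS) ≥ |C|K + 1
  have hL : |C| * K + 1 ≤ Real.sqrt (l * S0 + l * S1 + l * S2) := by
    have h1 : (|C| * K + 1) ^ 2 ≤ l * S := by
      have : (|C| * K + 1) ^ 2 / S ≤ l := le_max_right _ _
      rwa [div_le_iff₀ hSpos] at this
    have h2 : l * S0 + l * S1 + l * S2 = l * S := by rw [hS]; ring
    rw [h2]
    have hx : 0 ≤ |C| * K + 1 := by nlinarith [abs_nonneg C, hKnn]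
    calc |C| * K + 1 = Real.sqrt ((|C| * K + 1) ^ 2) := (Real.sqrt_sq hx).symm
      _ ≤ Real.sqrt (l * S) := Real.sqrt_le_sqrt h1
  -- right side ≤ |C| K
  have hR : C * ((l ^ 3)⁻¹ * I6) ^ ((1:ℝ) / 6) * I3 ^ ((1:ℝ) / 3) ≤ |C| * K := by
    have hl3 : (l ^ 3)⁻¹ ≤ 1 := inv_le_one_of_one_le₀ (one_le_pow₀ hl1)
    have hmono : ((l ^ 3)⁻¹ * I6) ^ ((1:ℝ) / 6) ≤ I6 ^ ((1:ℝ) / 6) :=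
      Real.rpow_le_rpow (mul_nonneg (inv_nonneg.2 (pow_nonneg hl0.le 3)) hI6nn)
        (by nlinarith) (by norm_num)
    have ha : 0 ≤ ((l ^ 3)⁻¹ * I6) ^ ((1:ℝ) / 6) :=
      Real.rpow_nonneg (mul_nonneg (inv_nonneg.2 (pow_nonneg hl0.le 3)) hI6nn) _
    have hb : 0 ≤ I3 ^ ((1:ℝ) / 3) := Real.rpow_nonneg hI3nn _
    calc C * ((l ^ 3)⁻¹ * I6) ^ ((1:ℝ) / 6) * I3 ^ ((1:ℝ) / 3)
        ≤ |C| * ((l ^ 3)⁻¹ * I6) ^ ((1:ℝ) / 6) * I3 ^ ((1:ℝ) / 3) := by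
          gcongr
          exact le_abs_self C
      _ ≤ |C| * I6 ^ ((1:ℝ) / 6) * I3 ^ ((1:ℝ) / 3) := by
          gcongr
      _ = |C| * K := by rw [hK]; ring
  linarith

end

end Summit.NavierStokesRegularity.NavierStokesRegularity.Theorems.PanPan2025
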